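import Summits.QuantumFields.YangMills.Theorems.BalabanUVNodesN06HolderPinsGradedAtRecord
import Literature.MathematicalPhysics.QuantumFieldTheory.Balaban1983to89.B9RWSums347DefiniteFaces

/-!
# BalabanUVNodes ∕ N06 ([B9], `Dag.B9_main`) — ROWS 20–21's `hXd` (the W-c face Φ^X_β∘∇_{U,ν}∘G₀∘D_U into the graded transported site class `bH13 x U`)
# DERIVED ABOVE A CLOSED THRESHOLD from the displayed (3.45)-species `h45X`, the plaquette binder `hF` and the MEMBER FACTS of the geometry of record
# (dag-n06-l's `hXd_of_pins` (p661566 (R4)) with `Facts347 ∕ RowSum` discharged by `facts347_exp261_geo9Y ∕ rowSum261_geo9Y`; input of edition 51)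

Track A of `YM-PLAN.md` (cell `pub-ymgap`, HUMAN RULING D-0062), node **N06** = [Balaban1985BackgroundPropagators] Thms 3.1–3.15; seat `pub-ymgap-dag-n06-d`
(gen 15).  WHY (dag-n06-l `ED47-REPLACEMENT-TABLE.md` row `hXd`; STEP 2 of the option-(2) pin edition).  Edition 49∕50 displays
`hXd : ∀ x, M12 ≤ M → … → ∀ ν β, HasMaj (bH13 x U) (𝔠_{P_X}^{(β−1)}) ((Φ^X_β ∘ ∇_{U,ν} ∘ G₀(U)) ∘ D_U) (BdX β·e^{−δ12₃ d})` with FREE `BdX`.  dag-n06-l's member-∀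
`N06HolderPinsGradedAtRecord.hXd_of_pins` derives it at the pin (P2) from the Φ^X-(3.45) members `h45X` READ AT THE TRANSPORTED BOND CLASS `bHZKT (taxiB U) (sch β) 1`
(print-inhabitable, exponent `sch β < 1`), the plaquette binder `hF`, and the member facts `Facts347 ∕ RowSum` (hypotheses there).  THIS FILE discharges the member
facts at the geometry of record and CHOOSES the free rates: ★★ `hXd_of_pins_geo9Y` — `∃ MX BdX, (∀ β ∈ [0,1), 0 ≤ BdX β) ∧ ∀ x, MX ≤ M → … → hXd-shape at rate δ₃` for ANY
target rate `0 ≤ δ₃ < δ45` (`δ45` = the rate of the displayed `h45X`): `Facts347` at `α := 1∕2`, `δF := δ45 − δ₃` (`facts347_exp261_geo9Y`, threshold `M_g`), `RowSum` at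
`σ := 1`, `cσ := max c₁ 0` (`rowSum261_geo9Y`, threshold `M_L`), `δJ := δ₃ + 1 + δF∕2`, `MX := max M₀ (max M_g M_L)`, and the CLOSED
`BdX β := (d+1)·((1 + C_Lip)·(BZ β·L)·(CJG d ℓ (trBasis N) 1 (thetaL d ℓ ϑF) (w13 (sch β)) δJ·L)·cσ)` (dag-n06-l's `hBdX` with equality).  The edition then displays
`h45X δ45 BZ sch ϑF` in place of `hXd BdX` and feeds `hXd` to the StepDirB layer at its own threshold `MX`.
HONEST FRAMING.  Kernel bookkeeping (∃-packaging of a landed member-∀ theorem with two landed member-fact theorems and explicit rate choices); the (3.45) members `h45X` and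
the plaquette binder `hF` are HYPOTHESES; nothing of [B9] asserted; COUNT-NEUTRAL; N06 NOT discharged; K1⁹ NOT closed; one finite 𝕋⁴ programme at fixed `ε` — NOT continuum ∕ OS ∕
mass gap ∕ Clay.  0 `def`, 0 `sorry`.
-/

noncomputable section

namespace Summit.QuantumFields.YangMills.BalabanUVNodes.N06XdLegAtPinsPhysRU

open Literature.MathematicalPhysics.QuantumFieldTheory.Balaban1983to89
open Literature.MathematicalPhysics.QuantumFieldTheory.Balaban1983to89.Node00 (FBondY IBondY SiteY levY toKT CfgY)
open Literature.MathematicalPhysics.QuantumFieldTheory.Balaban1983to89.B9Thm34Ext (toB6)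
open Literature.MathematicalPhysics.QuantumFieldTheory.Balaban1983to89.B11SectG (HasMaj BlockNorm RowSum)
open Literature.MathematicalPhysics.QuantumFieldTheory.Balaban1983to89.B9SectDSup (weightNorm)
open Literature.MathematicalPhysics.QuantumFieldTheory.Balaban1983to89.B9Thm312Whole (cNorm GeoOK)
open Literature.MathematicalPhysics.QuantumFieldTheory.Balaban1983to89.B9Thm312WholeClasses (cNormR)
open Literature.MathematicalPhysics.QuantumFieldTheory.Balaban1983to89.B9RWSums343Holder (HolderProbes)
open Literature.MathematicalPhysics.QuantumFieldTheory.Balaban1983to89.B9RWSums343to347Whole (Facts347)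
open Literature.MathematicalPhysics.QuantumFieldTheory.Balaban1983to89.B9RWSums346SecondDiff (DirOps310)
open Literature.MathematicalPhysics.QuantumFieldTheory.Balaban1983to89.B9Thm310Whole (Ops310)
open Literature.MathematicalPhysics.QuantumFieldTheory.Balaban1983to89.B9CoReadingCoords (coordOpK XBK blkBK cdBₗ cdsBₗ DcoK)
open Literature.MathematicalPhysics.QuantumFieldTheory.Balaban1983to89.B9CoReadingCoordsS (XSK sIK)
open Literature.MathematicalPhysics.QuantumFieldTheory.Balaban1983to89.B9CoReadingCoordsH (XHK)
open Literature.MathematicalPhysics.QuantumFieldTheory.Balaban1983to89.B9CoReadingCoordsHolder (PK)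
open Literature.MathematicalPhysics.QuantumFieldTheory.Balaban1983to89.B9CoReadingCoordsTranspose (TrIdx trBasis)
open Literature.MathematicalPhysics.QuantumFieldTheory.Balaban1983to89.B9PinMembersKLevelV1 (MemberY geo9Y bg9Y)
open Literature.MathematicalPhysics.QuantumFieldTheory.Balaban1983to89.B9BackgroundsKLevelV1R (RegFamY bg9YR MemOfFam mem_of_reg335R)
open Literature.MathematicalPhysics.QuantumFieldTheory.Balaban1983to89.B9GeoLemma21KLevelV1 (geo9Y_len_pos geo9Y_dist_triangle geo9Y_dist_comm rowSum261_geo9Y)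
open Literature.MathematicalPhysics.QuantumFieldTheory.Balaban1983to89.B9GeoNormsKLevelV1 (geo9K geo9K_dist_nonneg)
open Literature.MathematicalPhysics.QuantumFieldTheory.Balaban1983to89.B7Prop2SpecialUnitary (specialUnitaryUnits)
open Literature.MathematicalPhysics.QuantumFieldTheory.Balaban1983to89.B9RWSums347DefiniteFaces (exp261 facts347_exp261_geo9Y)
open B6GlobalChartV1 (PV blkV1) open B6Ineq2142KLevelV1 (β lvl) open B6Geom246MultiLevelTorus (geomT)
open Node00.OpsYSectDCoords (DvcoKH) open Node00.OpsYNablaBridge (chartY)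
open B9MultiscaleSmoothPartitionYLip (CLip) open B9SmoothHolderClassT (bHZT bHZKT)
open B9SmoothHolderClassGraded (bHZG bHZKG) open B9GradViaDivLettersTransported (taxiS taxiB)
open Literature.MathematicalPhysics.QuantumFieldTheory.Balaban1983to89.B9Thm313WholeDvHolderAtPinsGraded (thetaL CJG thetaL_nonneg CJG_nonneg)
open Literature.MathematicalPhysics.QuantumFieldTheory.Balaban1983to89.B9TaxiTransportLadder (plaqV)
open Summit.QuantumFields.YangMills.BalabanUVNodes.N06HolderPinsGradedAtRecord (hXd_of_pins)
open scoped Matrix.Norms.L2Operator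

variable {N : ℕ} {d ℓ : ℕ} {hd : 1 ≤ d + 1} {hL : Odd (ℓ + 1) ∧ 1 < ℓ + 1} {b₀ b₁ : ℝ} {Mstar : ℕ}

/-- `0 < CLip d ℓ` (it is `1 + 2·C₀·L²`). [cite: Balaban1984PropagatorsII, (2.52) p.232, bookkeeping] -/
theorem one_le_CLip (d ℓ : ℕ) : (1 : ℝ) ≤ CLip d ℓ := by
  unfold CLip
  have : (0 : ℝ) ≤ 2 * (B9MultiscaleSmoothPartitionYLip.C0 d : ℝ) * (((ℓ + 1 : ℕ) : ℝ)) ^ 2 := by positivity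
  linarith

/-- ★★ **`hXd` DERIVED ABOVE A CLOSED THRESHOLD** (module docstring): for any target rate `0 ≤ δ₃ < δ45`, from the displayed Φ^X-(3.45) members `h45X` (rate `δ45`, constants
`BZ β`, read at `bHZKT (taxiB U) (sch β) 1`), the plaquette binder `hF` (budget `ϑF ≥ 0`) and the pins, there are a threshold `MX` and a non-negative constant function
`BdX` with the certificate's `hXd` at rate `δ₃` for every member above `MX` — dag-n06-l's `hXd_of_pins` with `Facts347` (`α := 1∕2`, `δF := δ45 − δ₃`) and `RowSum`
(`σ := 1`) discharged at the geometry of record. [cite: Balaban1985BackgroundPropagators, Thm 3.3 p.399 + (3.45) p.398 + (3.40) p.397 + (3.35) p.396 + p.398 (remark after (3.47)); Balaban1984PropagatorsII, (2.52)–(2.56) pp.232–233 + Lemma 2.1 (2.59)–(2.61) pp.233–234] -/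
theorem hXd_of_pins_geo9Y [NeZero N] [∀ x : MemberY d ℓ hd hL b₀ b₁ Mstar, Fintype (geo9Y x).Site]
    {R₁ R₂ : RegFamY d ℓ hd hL b₀ b₁ Mstar (Matrix (Fin N) (Fin N) ℂ)} (H : MemberY d ℓ hd hL b₀ b₁ Mstar → Prop)
    (bI : ∀ x : MemberY d ℓ hd hL b₀ b₁ Mstar, FBondY x.toKIdx → IBondY x.toKIdx)
    (hβ1 : ∀ (x : MemberY d ℓ hd hL b₀ b₁ Mstar) (f : FBondY x.toKIdx), (geomT x.D).dist (β x.hN x.D x.hk (bI x f)) (blkV1 x.hN x.D f) ≤ 1)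
    (hbI0 : ∀ (x : MemberY d ℓ hd hL b₀ b₁ Mstar) (f : FBondY x.toKIdx), bI x f = bI x ⟨f.src, 0⟩)
    (hGR : MemOfFam (specialUnitaryUnits (Fin N)) R₁) (c : ℝ) {M₀ a₀ : ℝ} {ϑF : ℝ} (hϑF : 0 ≤ ϑF)
    (hF : ∀ x : MemberY d ℓ hd hL b₀ b₁ Mstar, letI : Fintype (geo9K x.toKIdx).Site := (inferInstance : Fintype (geo9Y x).Site); M₀ ≤ (geo9Y x).M → ∀ α₀ : ℝ, 0 < α₀ → (geo9Y x).M * α₀ ≤ a₀ → ∀ U : (bg9YR (Matrix (Fin N) (Fin N) ℂ) (specialUnitaryUnits (Fin N)) R₁ R₂ x).Cfg, (bg9YR (Matrix (Fin N) (Fin N) ℂ) (specialUnitaryUnits (Fin N)) R₁ R₂ x).Reg335 c α₀ U →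
      (bg9YR (Matrix (Fin N) (Fin N) ℂ) (specialUnitaryUnits (Fin N)) R₁ R₂ x).Reg336 c α₀ U → ∀ (y : Site (PV d ℓ x.m x.K hd hL) 0) (μ' ν' : Fin (d + 1)),
        ‖(plaqV U y μ' ν' : Matrix (Fin N) (Fin N) ℂ) - 1‖ ≤ ϑF * (((((ℓ + 1 : ℕ) : ℝ)) ^ levY x.toKIdx (chartY x.toKIdx y))⁻¹))
    (w13 : ℝ → ℝ) (hw13₀ : ∀ s, 0 ≤ w13 s) (hw13₁ : ∀ s, w13 s ≤ 1) (sch : ℝ → ℝ) (hsch0 : ∀ β', 0 ≤ β' → β' < 1 → 0 < sch β') (hsch1 : ∀ β', 0 ≤ β' → β' < 1 → sch β' < 1)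
    (hwsch : ∀ β', 0 ≤ β' → β' < 1 → 0 < w13 (sch β'))
    (bH13 : ∀ x : MemberY d ℓ hd hL b₀ b₁ Mstar, (bg9YR (Matrix (Fin N) (Fin N) ℂ) (specialUnitaryUnits (Fin N)) R₁ R₂ x).Cfg → BlockNorm (toB6 (geo9Y x) 1 (H x)) (XSK (TrIdx N) x.toKIdx → ℝ))
    (hbH13 : ∀ (x : MemberY d ℓ hd hL b₀ b₁ Mstar) (U : (bg9YR (Matrix (Fin N) (Fin N) ℂ) (specialUnitaryUnits (Fin N)) R₁ R₂ x).Cfg), bH13 x U =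
      letI : Fintype (geo9K x.toKIdx).Site := (inferInstance : Fintype (geo9Y x).Site);
      weightNorm (bHZG (κ := TrIdx N) x.toKIdx (trBasis N) (taxiS x.toKIdx (bg9YR (Matrix (Fin N) (Fin N) ℂ) (specialUnitaryUnits (Fin N)) R₁ R₂ x) (fun U => U) U) (R := (1 : ℝ)) (H := H x) le_rfl w13 hw13₀ hw13₁)
        (fun y => ((geo9Y x).len y)⁻¹) (fun y => inv_nonneg.2 (geo9Y_len_pos x y).le))
    {ιA AA : MemberY d ℓ hd hL b₀ b₁ Mstar → Type}
    (𝔬A : ∀ x : MemberY d ℓ hd hL b₀ b₁ Mstar, Ops310 (geo9Y x) (bg9YR (Matrix (Fin N) (Fin N) ℂ) (specialUnitaryUnits (Fin N)) R₁ R₂ x) (XBK (TrIdx N) x.toKIdx) (XBK (TrIdx N) x.toKIdx) (ιA x) (AA x))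
    (𝔬12 : ∀ x : MemberY d ℓ hd hL b₀ b₁ Mstar, B9Thm312Whole.Ops (geo9Y x) (bg9YR (Matrix (Fin N) (Fin N) ℂ) (specialUnitaryUnits (Fin N)) R₁ R₂ x) (XBK (TrIdx N) x.toKIdx) (XBK (TrIdx N) x.toKIdx) (XHK (TrIdx N) x.toKIdx) (XSK (TrIdx N) x.toKIdx))
    (hDvco12 : ∀ (x : MemberY d ℓ hd hL b₀ b₁ Mstar) (U : (bg9YR (Matrix (Fin N) (Fin N) ℂ) (specialUnitaryUnits (Fin N)) R₁ R₂ x).Cfg), (𝔬12 x).Dv U = DvcoKH x.toKIdx (trBasis N) (bg9YR (Matrix (Fin N) (Fin N) ℂ) (specialUnitaryUnits (Fin N)) R₁ R₂ x) (fun U => U) U)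
    (𝔡A : ∀ x : MemberY d ℓ hd hL b₀ b₁ Mstar, DirOps310 (𝔬A x) (Fin (d + 1)))
    (h𝔡As : ∀ (x : MemberY d ℓ hd hL b₀ b₁ Mstar) (U : (bg9YR (Matrix (Fin N) (Fin N) ℂ) (specialUnitaryUnits (Fin N)) R₁ R₂ x).Cfg), (𝔡A x).Dsd U = fun μ => coordOpK (trBasis N) (fun _ : Fin (d + 1) => cdsBₗ x.toKIdx U μ))
    (𝔭A : ∀ x : MemberY d ℓ hd hL b₀ b₁ Mstar, HolderProbes (geo9Y x) (bg9YR (Matrix (Fin N) (Fin N) ℂ) (specialUnitaryUnits (Fin N)) R₁ R₂ x) (XBK (TrIdx N) x.toKIdx) (XBK (TrIdx N) x.toKIdx) (PK (FBondY x.toKIdx) (Fin (d + 1)) (TrIdx N)) (PK (FBondY x.toKIdx) (Fin (d + 1)) (TrIdx N)))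
    {δ45 δ₃ : ℝ} (hδ₃ : 0 ≤ δ₃) (hδ : δ₃ < δ45) {BZ : ℝ → ℝ} (hBZ : ∀ β', 0 ≤ β' → β' < 1 → 0 ≤ BZ β')
    (h45X : ∀ x : MemberY d ℓ hd hL b₀ b₁ Mstar, letI : Fintype (geo9K x.toKIdx).Site := (inferInstance : Fintype (geo9Y x).Site); M₀ ≤ (geo9Y x).M → ∀ α₀ : ℝ, 0 < α₀ → (geo9Y x).M * α₀ ≤ a₀ → ∀ U : (bg9YR (Matrix (Fin N) (Fin N) ℂ) (specialUnitaryUnits (Fin N)) R₁ R₂ x).Cfg, (bg9YR (Matrix (Fin N) (Fin N) ℂ) (specialUnitaryUnits (Fin N)) R₁ R₂ x).Reg335 c α₀ U →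
      (bg9YR (Matrix (Fin N) (Fin N) ℂ) (specialUnitaryUnits (Fin N)) R₁ R₂ x).Reg336 c α₀ U → ∀ (ν μ : Fin (d + 1)) (β' : ℝ) (h0 : 0 ≤ β') (h1 : β' < 1),
        HasMaj (bHZKT (κ := TrIdx N) x.toKIdx (trBasis N) (taxiB x.toKIdx (bg9YR (Matrix (Fin N) (Fin N) ℂ) (specialUnitaryUnits (Fin N)) R₁ R₂ x) (fun U => U) U) (R := (1 : ℝ)) (H := H x) (hsch0 β' h0 h1).le (hsch1 β' h0 h1).le (hsch1 β' h0 h1).le) (BlockNorm.ofBlocks (toB6 (geo9Y x) 1 (H x)) (𝔭A x).blkPX)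
          ((𝔭A x).ΦX U β' ∘ₗ ((𝔡A x).Dd U ν ∘ₗ ((𝔬12 x).G0 U ∘ₗ (𝔡A x).Dsd U μ)))
          (fun a a' => BZ β' * (geo9Y x).len a ^ (-β') * Real.exp (-(δ45 * (geo9Y x).dist a a')))) :
    ∃ (MX : ℝ) (BdX : ℝ → ℝ), (∀ β', 0 ≤ β' → β' < 1 → 0 ≤ BdX β') ∧
      ∀ x : MemberY d ℓ hd hL b₀ b₁ Mstar, MX ≤ (geo9Y x).M → ∀ α₀ : ℝ, 0 < α₀ → (geo9Y x).M * α₀ ≤ a₀ →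
        ∀ U : (bg9YR (Matrix (Fin N) (Fin N) ℂ) (specialUnitaryUnits (Fin N)) R₁ R₂ x).Cfg, (bg9YR (Matrix (Fin N) (Fin N) ℂ) (specialUnitaryUnits (Fin N)) R₁ R₂ x).Reg335 c α₀ U →
          (bg9YR (Matrix (Fin N) (Fin N) ℂ) (specialUnitaryUnits (Fin N)) R₁ R₂ x).Reg336 c α₀ U → ∀ (ν : Fin (d + 1)) (β' : ℝ), 0 ≤ β' → β' < 1 →
            HasMaj (bH13 x U) (cNormR 1 (H x) (𝔭A x).blkPX (fun y => (geo9Y_len_pos x y).le) (β' - 1))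
              (((𝔭A x).ΦX U β' ∘ₗ (𝔡A x).Dd U ν ∘ₗ (𝔬12 x).G0 U) ∘ₗ (𝔬12 x).Dv U)
              (fun a a' => BdX β' * Real.exp (-(δ₃ * (geo9Y x).dist a a'))) := by
  -- the member facts of the (3.47) passage at α := 1∕2, δF := δ45 − δ₃, and [4] (2.61) at rate 1
  have hδF : 0 < δ45 - δ₃ := sub_pos.2 hδ
  obtain ⟨Mg, hFa⟩ := facts347_exp261_geo9Y (d := d) (ℓ := ℓ) (hd := hd) (hL := hL) (b₀ := b₀) (b₁ := b₁) (Mstar := Mstar) H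
    (α := 1 / 2) (by norm_num) (by norm_num) hδF
  obtain ⟨ML, c₁, hrow⟩ := rowSum261_geo9Y (d := d) (ℓ := ℓ) (hd := hd) (hL := hL) (b₀ := b₀) (b₁ := b₁) (Mstar := Mstar) 1 one_pos
  set L₀ : ℝ := ((ℓ + 1 : ℕ) : ℝ) with hL₀
  set δJ : ℝ := δ₃ + 1 + 1 / 2 * (δ45 - δ₃) with hδJ
  have hδJ0 : 0 ≤ δJ := by rw [hδJ]; nlinarith
  refine ⟨max M₀ (max Mg ML),
    fun β' => ((d : ℝ) + 1) * ((1 + CLip d ℓ) * (BZ β' * L₀) * ((CJG d ℓ (trBasis N) 1 (thetaL d ℓ ϑF) (w13 (sch β')) δJ) * L₀) * max c₁ 0), ?_, ?_⟩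
  · intro β' h0 h1
    have h1C : 0 ≤ 1 + CLip d ℓ := by linarith [one_le_CLip d ℓ]
    have hJ := CJG_nonneg (d := d) (ℓ := ℓ) (trBasis N) (p := (1 : ℝ)) (thetaL_nonneg d ℓ hϑF) (hwsch β' h0 h1) δJ
    have := hBZ β' h0 h1
    positivity
  · intro x hM α₀ hα ha U hU hU' ν β' h0 h1
    have hM0 : M₀ ≤ (geo9Y x).M := (le_max_left _ _).trans hM
    have hMg : Mg ≤ (geo9Y x).M := ((le_max_left _ _).trans (le_max_right _ _)).trans hM
    have hML : ML ≤ (geo9Y x).M := ((le_max_right _ _).trans (le_max_right _ _)).trans hM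
    have hrowx : ∀ x : MemberY d ℓ hd hL b₀ b₁ Mstar, max M₀ (max Mg ML) ≤ (geo9Y x).M → RowSum (toB6 (geo9Y x) 1 (H x)) 1 (max c₁ 0) :=
      fun x hM y => (hrow x (((le_max_right _ _).trans (le_max_right _ _)).trans hM) y).trans (le_max_left _ _)
    exact hXd_of_pins H bI hβ1 hbI0 hGR c (M₀ := max M₀ (max Mg ML)) (a₀ := a₀) hϑF
      (fun x hM α₀ hα ha U hU hU' => hF x ((le_max_left _ _).trans hM) α₀ hα ha U hU hU')
      (fun x hM => hFa x (((le_max_left _ _).trans (le_max_right _ _)).trans hM)) hrowx w13 hw13₀ hw13₁ sch hsch0 hsch1 hwsch bH13 hbH13 𝔬A 𝔬12 hDvco12 𝔡A h𝔡As 𝔭A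
      (δ₀ := δ45) (δJ := δJ) (δ₃ := δ₃) hBZ (le_max_right _ _) hδJ0 hδ₃ (by rw [hδJ] at *; linarith) (by rw [hδJ]; linarith) (fun β' h0 h1 => le_rfl)
      (fun x hM α₀ hα ha U hU hU' => h45X x ((le_max_left _ _).trans hM) α₀ hα ha U hU hU') x hM α₀ hα ha U hU hU' ν β' h0 h1

end Summit.QuantumFields.YangMills.BalabanUVNodes.N06XdLegAtPinsPhysRU

end
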